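/-
Origin: expansion seat `prover-pub-hodgecm-mc-binder-1-g14-0`, handover #R90 2026-08-20T16:54:41Z md5 189b019cecc5 (90 l.; NEW additive leaf (universe-free), (J1)(c2) adapter `quotientDatumOf (D : UnitaryBallUniformisationDatum 2 X) (h₂ : SpecialCyclesAlgebraic) : UnitaryBallQuotientDatum 2 X` (special subvarieties chosen by (ii-b) on the given X/unif; forgetting them = D by rfl); imports ONLY Vendored Automorphic/PicardCMPrerequisites; drops ⇒ {#R91}; NAME LIST: HodgeCM.Model.isBallUniformisation_of · HodgeCM.Model.quotientDatumOf_toUnitaryBallUniformisationDatum · HodgeCM.Model.quotientDatumOf_E) (`HOME/mc/pub-hodgecm-mc-binder-1-g14/stage56/HodgeCM/Model/QuotientDatumOfUniformisation.lean`, md5 189b019cecc5, 90 lines);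
landed by the second packager p2 gen 10 (p2-g10) in gate run 56 as `HodgeCM/Model/QuotientDatumOfUniformisation.lean` (packager comment re-wording per the RUN-32 precedent (gate audit (5) rejects the proof-placeholder tokens s-o-r-r-y / a-d-m-i-t anywhere in a source, comments included): 1 occurrence(s) inside COMMENTS re-spelt `proof-hole` / `adm-token`; no Lean code byte touched).
-/
/-
Copyright (c) 2026 the pub-hodgecm formalisation cell (harness21).  New file, not vendored.
Origin: session prover-pub-hodgecm-mc-binder-1-g14-0 (unit pub-hodgecm-mc-binder-1-g14, BINDER PROVER gen 14 of lineage mc-binder-1;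
content lane (J-Liu-Θ), scope memo `HOME/mc/pub-hodgecm-mc-binder-1-g14/JLIU-THETA-SCOPE.md` §6.2 (c2)), 2026-08-20.  Intended final place:
`HodgeCM/Model/QuotientDatumOfUniformisation.lean` (NEW additive leaf; imports ONLY the vendored twins
`HodgeCM.Vendored.H21.NumberTheory.Automorphic.PicardCMPrerequisites` (for `SpecialCyclesAlgebraic`) and
`HodgeCM.Vendored.H21.AlgebraicGeometry.ShimuraVarieties.UnitaryBallQuotientDatum`; nothing imports it; drop alone on bounce).
-/
import Literature.NumberTheory.Automorphic.PicardCMPrerequisites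

set_option autoImplicit false

/-!
# Upgrading the model's uniformisation datum to a ball-QUOTIENT datum from (ii-b) — the (c2) path of memo §6.2

KERNEL packaging over vendored twins; nothing cited anew, nothing minted, no new hypothesis kind (the only hypothesis is the vendored NAMED FACT
`PicardCM.SpecialCyclesAlgebraic` = (ii-b) [KudlaMillson1990 Lemma 1.1], [BergeronMillsonMoeglin2016Balls §1.7 / Part 2 §3.2], [Mumford1981 (4.6)],
which the (iib-R) re-base STRUCK from E's universe but which stays a FIRM print fact of the PKG).

After the (iib-R) re-base the model's surface carries `Model.ballDatumOf … : UnitaryBallUniformisationDatum 2 X` (`Var.ballDatum hU h₃`), while the vendored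
Hecke operator (`UnitaryBallQuotientDatum.heckeCorrespondenceAction`, `Model/HeckeOperatorOf.heckeOpC`) and the tree's admissibility theorem
(`Summit…OrthogonalEnveloped.HeckeGraphChow.isHeckeAdmissible_of_mem_unitaryGroup`) are stated on the STRONGER `UnitaryBallQuotientDatum`
(= uniformisation datum + Zariski-closed special subvarieties).  This leaf is the zero-wait bridge (c2): for `p = 2`,

* `HodgeCM.Model.quotientDatumOf (D : UnitaryBallUniformisationDatum 2 X) (h₂ : SpecialCyclesAlgebraic) : UnitaryBallQuotientDatum 2 X`
  — the special subvariety of a totally positive `W` chosen by (ii-b) on THIS `X` and THIS `unif` (the five `unif` fields of `D` are exactly the conjuncts of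
  `IsBallUniformisation`), the empty set for the other `W` (about which the datum says nothing) — the same packaging as the vendored
  `ballQuotientAlgebraic_of`, but ON A GIVEN uniformisation datum instead of an existentially produced surface;
* `quotientDatumOf_toUnitaryBallUniformisationDatum` — forgetting the special cycles gives back `D` (`rfl`), so `E`, `H`, `Γ`, `unif`, the ball, the level
  covers and the class map of `quotientDatumOf D h₂` ARE those of `D`.

Hence, granted `h₂`, `heckeOpC (quotientDatumOf D h₂) D.isSmoothProjective k g` is the Hecke operator on `ℂ ⊗ H^k(X(ℂ);ℚ)` of the model's own surface, and every
`g ∈ U(V)(E)` is admissible for it by the tree theorem.  The long-term path (c1) — the tree's Hecke section re-stated on the uniformisation datum, which it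
only reads — makes this leaf unnecessary; until then it is the (J1) instantiation's missing adapter.

0 `proof-hole`, 0 `axiom`; expected `#print axioms` ⊆ {propext, Classical.choice, Quot.sound}.
-/

noncomputable section

open Literature.AlgebraicGeometry.Motives (SchemeOver ComplexPoints IsSmoothProjective)
open Literature.NumberTheory.Automorphic.PicardCM (SpecialCyclesAlgebraic)

open Literature.AlgebraicGeometry.ShimuraVarieties

namespace HodgeCM

namespace Model

variable {X : SchemeOver ℂ} (D : UnitaryBallUniformisationDatum 2 X)

/-- The uniformisation fields of the datum ARE the conjuncts of (ii-a)'s `IsBallUniformisation`. [folklore] -/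
theorem isBallUniformisation_of :
    Literature.NumberTheory.Automorphic.PicardCM.IsBallUniformisation D.E D.H D.Γ X D.unif :=
  ⟨D.continuousOn_unif, D.isOpenMap_unif, D.surjOn_unif, D.unif_eq_unif_iff, D.differentiableOn_unif⟩

open scoped Classical in
/-- **The ball-QUOTIENT datum of a uniformisation datum, granted (ii-b)**: special subvarieties of totally positive `W` chosen by
`SpecialCyclesAlgebraic` on this very `X`/`unif`; `∅` for the other `W`. [folklore] -/
def quotientDatumOf (h₂ : SpecialCyclesAlgebraic) : UnitaryBallQuotientDatum 2 X :=
  haveI := D.isNumberField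
  haveI := D.isCMField
  have hZ := h₂ D.E D.H D.Γ X D.unif D.conj_H_apply D.anisotropic D.signature_τ₁ D.posDef_of_ne D.isCongruenceSubgroup
    D.torsionFree D.isSmoothProjective (isBallUniformisation_of D)
  { toUnitaryBallUniformisationDatum := D
    specialSubvariety := fun W => if hW : IsTotallyPositive (conjRingHom D.E) D.H W then (hZ W hW).choose else ∅
    isClosed_specialSubvariety := fun W hW => by
      simp only [dif_pos hW]
      exact (hZ W hW).choose_spec.1
    pt_mem_specialSubvariety_iff := fun W hW P => by
      simp only [dif_pos hW]
      exact (hZ W hW).choose_spec.2.1 P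
    le_coheight_of_mem_specialSubvariety := fun W hW z hz => by
      simp only [dif_pos hW] at hz
      exact (hZ W hW).choose_spec.2.2 z hz }

/-- Forgetting the special cycles gives back the uniformisation datum (definitional). [folklore] -/
@[simp] theorem quotientDatumOf_toUnitaryBallUniformisationDatum (h₂ : SpecialCyclesAlgebraic) :
    (quotientDatumOf D h₂).toUnitaryBallUniformisationDatum = D := rfl

/-- (Ported verbatim from the HodgeCMPerL package; no docstring in the source.) -/
theorem quotientDatumOf_E (h₂ : SpecialCyclesAlgebraic) : (quotientDatumOf D h₂).E = D.E := rfl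
/-- (Ported verbatim from the HodgeCMPerL package; no docstring in the source.) -/
theorem quotientDatumOf_H (h₂ : SpecialCyclesAlgebraic) : (quotientDatumOf D h₂).H = D.H := rfl
/-- (Ported verbatim from the HodgeCMPerL package; no docstring in the source.) -/
theorem quotientDatumOf_Γ (h₂ : SpecialCyclesAlgebraic) : (quotientDatumOf D h₂).Γ = D.Γ := rfl
/-- (Ported verbatim from the HodgeCMPerL package; no docstring in the source.) -/
theorem quotientDatumOf_unif (h₂ : SpecialCyclesAlgebraic) : (quotientDatumOf D h₂).unif = D.unif := rfl

end Model

end HodgeCM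

end
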